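import Summits.BirchSwinnertonDyer.BirchSwinnertonDyer.Theorems.KolyvaginRankRigidityAtTwoClassesIntoSelmerBadDefectZhang
import Summits.BirchSwinnertonDyer.BirchSwinnertonDyer.Theorems.KolyvaginRankRigidityAtTwoClassesIntoSelmerGood
import HarnessLib

/-!
# Route `KolyvaginRankRigidityAtTwo`, crux V2♭ (stmt-BirchSwinnertonDyer-24623), sub-rung (i) ASSEMBLED:
# the concrete Kolyvagin class, times the bounded defect `n′`, is a SELMER class — in `Sel^{(p^M)}(E/K)`
# and in `Sel_{p^∞}(E/K)` — modulo [GZ86 III (3.1)] at the bad places and the TRANSVERSE condition at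
# the primes `ℓ ∣ m` (the research kernel, kept as a displayed hypothesis); any prime `p`, `p = 2` included

Width prover `bsd-line-krr2-p2` (g5), LEAD re-tasking 05:52Z; `--supports stmt-BirchSwinnertonDyer-24623
--as helper`. THEOREMS ONLY; BSD is not proved by any of this; nothing about Kolyvagin's conjecture or
Kolyvagin's structure theorem at `2` is asserted.

* `zsmul_kolyvaginClass_mem_selmerGroup_of_GZ31_of_transverse` — for the tree's concrete data `d m`
  at the divisors of a square-free product `n` of Zhang–Kolyvagin primes of index `≥ M` (`K` imaginary
  quadratic, `(N, d_K) = 1`, `d_K < −4`): GIVEN `hGZ` (the cell's labelled input [GZ86 III (3.1)] with a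
  multiplier `n′`, NO coprimality with `p`), `hA` (admissibility of every `E(K[m])`, at `p = 2` the
  route's `isAdmissible_pointsSubgroup_two`), and, for the level `m ∣ n` at hand, the TRANSVERSE local
  condition of `n′ • c_M(m)` at the places `v ∣ m` (McCallum Prop. 4.4 ∕ Kolyvagin's formula — NOT
  supplied here), the class `n′ • c_M(m)` lies in `Sel^{(p^M)}(E/K)`: finite `v ∤ m` by
  `zsmul_kolyvaginClass_mem_selmerLocalKer_of_GZ31_zhang` (good and bad alike), infinite places by
  `kolyvaginClass_mem_selmerLocalKer_infinitePlace`;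
* `torsionPowToPrimaryH1_zsmul_kolyvaginClass_mem_selmerGroupPInfty_of_GZ31_of_transverse` — its image
  under `torsionPowToPrimaryH1` lies in `Sel_{p^∞}(E/K)` (the currency of V2♭'s `ℤ₂`-coranks and of
  krr2-p2 g0's `lowerBound_of_triangularSystems`).

References (locators only): [cite: GrossLMS1991, §6 Prop. 6.2 (1)–(2), Prop. 3.7, §4 Lemma 4.3]
[cite: McCallumLMS1991, §4 Lemma 4.3, Prop. 4.4] [cite: GrossZagier1986, III (3.1)] [cite: Greenberg1999, §2].
-/

set_option autoImplicit false
-- the Theorems namespace of this sub repeats the summit name by design (D-0017 nested layout)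
set_option linter.dupNamespace false

noncomputable section

open scoped Classical
open scoped AddSubgroup

namespace Summit.BirchSwinnertonDyer.BirchSwinnertonDyer.Theorems.KolyvaginRankRigidity

open WeierstrassCurve NumberField IsDedekindDomain Field Finset
  Literature.NumberTheory.EllipticCurves Literature.NumberTheory.GaloisRepresentations
  Literature.NumberTheory.EllipticCurves.KolyvaginCocycle
  Literature.NumberTheory.EllipticCurves.KolyvaginEuler
  Literature.NumberTheory.EllipticCurves.RingClassField
  Literature.NumberTheory.EllipticCurves.ModularForms
  Summit.BirchSwinnertonDyer.Rank1Residual.X11b Summit.BirchSwinnertonDyer.Rank1Residual.X11b.Three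

-- `K : Type`: the tree's ring-class class field theory is universe `0`.
variable {K : Type} [Field K] [NumberField K] {N : ℕ} {W : WeierstrassCurve ℚ}

/-- **`n′ • c_M(m)` is a Selmer class, modulo [GZ86 III (3.1)] at the bad places and the transverse
condition at `v ∣ m`.** See the module docstring for the binders; the finite places `v ∤ m` are
`zsmul_kolyvaginClass_mem_selmerLocalKer_of_GZ31_zhang` (JET's Prop. 6.2 (1) replay, coprimality-free),
the infinite places impose nothing (`K` is totally complex). [cite: GrossLMS1991, §6 Prop. 6.2]
[cite: McCallumLMS1991, Lemma 4.3, Prop. 4.4] [cite: GrossZagier1986, III (3.1)] -/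
theorem zsmul_kolyvaginClass_mem_selmerGroup_of_GZ31_of_transverse [NeZero N] [W.IsElliptic]
    [W.IsGloballyMinimal] (hK : IsImaginaryQuadratic K) (ι : K →+* ℂ)
    {p M : ℕ} (hp : p.Prime)
    (Dt : ModularParametrizationData W N) {β : ℤ}
    (hND : IsCoprime (N : ℤ) (NumberField.discr K)) (hD : NumberField.discr K < -4)
    {n : ℕ} (hn : Squarefree n)
    (hkol : ∀ q ∈ n.primeFactors,
      Zhang2014.IsKolyvaginPrime N W K p q ∧ M ≤ Zhang2014.kolyvaginIndex W p q)
    (d : (m : ℕ) → m ∣ n → KolyvaginHeegnerData Dt β ι m)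
    {n' : ℤ}
    (hGZ : ∀ (m : ℕ) (hm : m ∣ n) (γ : ringClassField K ι m ≃ₐ[ℚ] ringClassField K ι m),
      γ ∈ ringClassGal ι m → ∀ v : HeightOneSpectrum (𝓞 K), ¬ (W.baseChange K).HasGoodReductionAt v →
        n' • pointsMap (W.baseChange K) (v.adicCompletion K)
            ((d m hm).toGeomPoints (pointGalHom W (ringClassField K ι m) γ (d m hm).y)) ∈
          E0Receptacle (W.baseChange K) v ∧
        ∀ (ℓ : ℕ) (hℓ : ℓ ∈ m.primeFactors)
          (hle : ringClassField K ι (m / ℓ) ≤ ringClassField K ι m),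
          n' • pointsMap (W.baseChange K) (v.adicCompletion K)
              ((d m hm).toGeomPoints (pointGalHom W (ringClassField K ι m) γ
                (WeierstrassCurve.Affine.Point.map (W' := W)
                  ((RingClassField.inclusion ι hle).restrictScalars ℚ)
                  (d (m / ℓ) ((Nat.div_dvd_of_dvd (Nat.dvd_of_mem_primeFactors hℓ)).trans hm)).y))) ∈
            E0Receptacle (W.baseChange K) v)
    (hA : ∀ (m : ℕ) (hm : m ∣ n),
      IsAdmissible (absoluteGaloisGroup K) (d m hm).pointsSubgroup ((p ^ M : ℕ) : ℤ))
    (m : ℕ) (hm : m ∣ n)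
    (htrans : ∀ v : HeightOneSpectrum (𝓞 K), (m : 𝓞 K) ∈ v.asIdeal →
      n' • (d m hm).kolyvaginClass hp M ∈
        selmerLocalKer (W.baseChange K) (v.adicCompletion K) ((p ^ M : ℕ) : ℤ)) :
    n' • (d m hm).kolyvaginClass hp M ∈ selmerGroup (W.baseChange K) ((p ^ M : ℕ) : ℤ) := by
  rw [mem_selmerGroup_iff]
  refine ⟨fun v ↦ ?_, fun w ↦ AddSubgroup.zsmul_mem _
    (kolyvaginClass_mem_selmerLocalKer_infinitePlace (d m hm) hK hp M w) n'⟩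
  by_cases hv : (m : 𝓞 K) ∈ v.asIdeal
  · exact htrans v hv
  · exact zsmul_kolyvaginClass_mem_selmerLocalKer_of_GZ31_zhang hK ι hp Dt hND hD hn hkol d hGZ hA
      m hm v hv

/-- **… and its image lies in `Sel_{p^∞}(E/K)`** (`torsionPowToPrimaryH1`, Greenberg 1999 §2; the
currency of the `ℤ_p`-corank statements). [cite: Greenberg1999, §2 (p. 63)] [cite: GrossLMS1991, §6 Prop. 6.2] -/
theorem torsionPowToPrimaryH1_zsmul_kolyvaginClass_mem_selmerGroupPInfty_of_GZ31_of_transverse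
    [NeZero N] [W.IsElliptic] [W.IsGloballyMinimal] (hK : IsImaginaryQuadratic K) (ι : K →+* ℂ)
    {p M : ℕ} (hp : p.Prime)
    (Dt : ModularParametrizationData W N) {β : ℤ}
    (hND : IsCoprime (N : ℤ) (NumberField.discr K)) (hD : NumberField.discr K < -4)
    {n : ℕ} (hn : Squarefree n)
    (hkol : ∀ q ∈ n.primeFactors,
      Zhang2014.IsKolyvaginPrime N W K p q ∧ M ≤ Zhang2014.kolyvaginIndex W p q)
    (d : (m : ℕ) → m ∣ n → KolyvaginHeegnerData Dt β ι m)
    {n' : ℤ}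
    (hGZ : ∀ (m : ℕ) (hm : m ∣ n) (γ : ringClassField K ι m ≃ₐ[ℚ] ringClassField K ι m),
      γ ∈ ringClassGal ι m → ∀ v : HeightOneSpectrum (𝓞 K), ¬ (W.baseChange K).HasGoodReductionAt v →
        n' • pointsMap (W.baseChange K) (v.adicCompletion K)
            ((d m hm).toGeomPoints (pointGalHom W (ringClassField K ι m) γ (d m hm).y)) ∈
          E0Receptacle (W.baseChange K) v ∧
        ∀ (ℓ : ℕ) (hℓ : ℓ ∈ m.primeFactors)
          (hle : ringClassField K ι (m / ℓ) ≤ ringClassField K ι m),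
          n' • pointsMap (W.baseChange K) (v.adicCompletion K)
              ((d m hm).toGeomPoints (pointGalHom W (ringClassField K ι m) γ
                (WeierstrassCurve.Affine.Point.map (W' := W)
                  ((RingClassField.inclusion ι hle).restrictScalars ℚ)
                  (d (m / ℓ) ((Nat.div_dvd_of_dvd (Nat.dvd_of_mem_primeFactors hℓ)).trans hm)).y))) ∈
            E0Receptacle (W.baseChange K) v)
    (hA : ∀ (m : ℕ) (hm : m ∣ n),
      IsAdmissible (absoluteGaloisGroup K) (d m hm).pointsSubgroup ((p ^ M : ℕ) : ℤ))
    (m : ℕ) (hm : m ∣ n)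
    (htrans : ∀ v : HeightOneSpectrum (𝓞 K), (m : 𝓞 K) ∈ v.asIdeal →
      n' • (d m hm).kolyvaginClass hp M ∈
        selmerLocalKer (W.baseChange K) (v.adicCompletion K) ((p ^ M : ℕ) : ℤ)) :
    torsionPowToPrimaryH1 (W.baseChange K) p M (n' • (d m hm).kolyvaginClass hp M) ∈
      selmerGroupPInfty (W.baseChange K) p :=
  torsionPowToPrimaryH1_mem_selmerGroupPInfty_of_mem W p M
    (zsmul_kolyvaginClass_mem_selmerGroup_of_GZ31_of_transverse hK ι hp Dt hND hD hn hkol d hGZ hA m hm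
      htrans)

end Summit.BirchSwinnertonDyer.BirchSwinnertonDyer.Theorems.KolyvaginRankRigidity

end
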